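import Summits.Langlands.Langlands.Theses.ExteriorSquareAscent
import Literature.NumberTheory.Automorphic.PairLFunctionPolesGLOneBoundaryProofs
import Literature.NumberTheory.Automorphic.PairLFunctionPolesGLOneDedekindProofs
import Literature.NumberTheory.Automorphic.BockleHuiIrreducibleGL3AnalyticProofs
import HarnessLib

/-!
# `PairLPoleJS` — negative lane: `S.Finite`, `s₀ ∈ X` and the Satake linkage are load-bearing

Refuter-side support for the crux `PairLPoleJS` (item stmt-Langlands-19093, route
`route-Langlands-ExteriorSquareAscent`; Arthur–Clozel, Ann. of Math. Stud. 120, Ch. 3 §2 (2.3) = Jacquet–Shalika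
II Prop. 3.6 for Borel–Jacquet data: the simple pole of `L^S(s, π × π')` at the points `s₀ ∈ X` of
`Re s = 1`), cycle 1 of the standing disprover (`Cruxes/PairLPoleJS/Disproof.lean` §(a)). No statement of the
route is proved or refuted: each theorem refutes a WEAKENING of the crux (stated inline, verbatim the crux
text with one clause removed), in the inhabitable rank `1` over `ℚ` or for data-free families.

* `pairLPoleJS_false_without_finite` — the crux with `S.Finite` dropped is FALSE: `S = univ ⊇ S₀` empties
  the Euler product (`∏'` over an empty type is `1`) and `(s - 1) · 1 → 0`.
* `pairLPoleJS_false_without_X` — the crux with the membership `s₀ ∈ X` dropped is FALSE: trivial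
  characters of `GL_1(𝔸_ℚ)`, `α = β = {1}`, `s₀ = 1 + i`: `L^S = ζ_ℚ^S` is regular and non-zero at `1 + i`
  (Landau; tree `tendsto_tprod_eulerFactor_one_of_ne_one_numberField`), so `(s - s₀) ζ_ℚ^S(s) → 0`. Any
  proof must use `X`.
* `pairLPoleJS_false_without_satakeLink` — the crux with the link `HasSatakeParamAt` to cuspidal data
  dropped (keeping `card α_w = card β_w = n`, unitarity and `X`) is FALSE from rank `2` on: the unitary
  family `α_w = β_w = {1, -1}` lies in `X` at `s₀ = 1` and `L^S(s) = ζ_ℚ^S(2s)²` is regular at `1`. So the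
  pole of (2.3) is automorphic input (`π' ≅ π̃ ⊗ |·|^{1-s₀}`), not a property of unitary Euler products of
  Satake type in `X`; in rank `1` the weakened statement is true (`L^S = ζ^S(s - s₀ + 1)`).

Companions: `WithoutPos.lean` (the guard `0 < n` is load-bearing: the constant datum on `GL_0`) and
`ReEqOneOfSatakeX.lean` (`hs₀ : s₀.re = 1` is implied by the other hypotheses).
-/

noncomputable section

set_option linter.dupNamespace false -- project-wide option (lakefile weak.linter.dupNamespace); `Summit.Langlands.Langlands` is the mandated namespace

open scoped Topology MatrixGroups
open NumberField IsDedekindDomain MeasureTheory Filter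
open Literature.NumberTheory.Automorphic AdelicGroupData
open Literature.NumberTheory.GaloisRepresentations

namespace Summit.Langlands.Langlands.Theorems.PairLPoleJS.Negative

/-! ### Small analytic helpers -/

/-- Every point of the line `Re s = 1` is adherent to the half-plane `Re s > 1`, so the filter of
Arthur–Clozel (2.3) at `s₀` is non-trivial. [folklore] -/
theorem nhdsWithin_one_lt_re_neBot_of_re_eq_one {s₀ : ℂ} (hs₀ : s₀.re = 1) :
    (𝓝[{s : ℂ | 1 < s.re}] s₀).NeBot := by
  refine mem_closure_iff_nhdsWithin_neBot.mp ?_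
  rw [Complex.closure_setOf_lt_re]
  simp [hs₀]

/-- `s - s₀ → 0` as `s → s₀` inside `Re s > 1`. [folklore] -/
theorem tendsto_sub_nhdsWithin_one_lt_re (s₀ : ℂ) :
    Tendsto (fun s : ℂ => s - s₀) (𝓝[{s : ℂ | 1 < s.re}] s₀) (𝓝 0) := by
  have : Tendsto (fun s : ℂ => s - s₀) (𝓝 s₀) (𝓝 (s₀ - s₀)) :=
    (continuous_id.sub continuous_const).tendsto s₀
  rw [sub_self] at this
  exact this.mono_left nhdsWithin_le_nhds

/-! ### Load-bearing hypotheses of `PairLPoleJS` -/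

/-- **`S.Finite` is load-bearing.** Witness: `n = 1`, `F = ℚ`, the trivial character, `S = univ ⊇ S₀`,
`α = β = ∅` (all place-wise hypotheses are vacuous off `univ`), `s₀ = 1`: the product over the empty
index type is `1` and `(s - 1) · 1 → 0`, so no non-zero limit exists. [folklore] -/
theorem pairLPoleJS_false_without_finite :
    ¬ (∀ (n : ℕ) (F : Type) [Field F] [NumberField F] (hF : isCompact_glFiniteIntegralLevel n F), 0 < n →
        ∀ (π π' : CuspidalAutomorphicRepData n F hF),
        ∃ S₀ : Set (HeightOneSpectrum (𝓞 F)), S₀.Finite ∧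
          ∀ {S : Set (HeightOneSpectrum (𝓞 F))}, S₀ ⊆ S →
          ∀ {α β : HeightOneSpectrum (𝓞 F) → Multiset ℂ},
            (∀ w ∉ S, π.1.HasSatakeParamAt w (α w)) → (∀ w ∉ S, π'.1.HasSatakeParamAt w (β w)) →
            (∀ w ∉ S, ‖(α w).prod‖ = 1) → (∀ w ∉ S, ‖(β w).prod‖ = 1) →
            ∀ {s₀ : ℂ}, s₀.re = 1 →
              (∀ᶠ w in cofinite, (α w).map ((((w.residueCard : ℂ) ^ (1 - s₀))) * ·) = (β w).map (·⁻¹)) →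
              ∃ c : ℂ, c ≠ 0 ∧ Tendsto (fun s : ℂ => (s - s₀) *
                ∏' w : {w : HeightOneSpectrum (𝓞 F) // w ∉ S},
                  ((satakePairPolynomial (α w.1) (β w.1)).eval ((w.1.residueCard : ℂ) ^ (-s)))⁻¹)
                (𝓝[{s : ℂ | 1 < s.re}] s₀) (𝓝 c)) := by
  intro h
  have h1 : isCompact_glFiniteIntegralLevel 1 ℚ := isCompact_glFiniteIntegralLevel_holds 1 ℚ
  -- the trivial character of `GL_1(𝔸_ℚ)` as a Borel–Jacquet datum [cite: BorelJacquet1979, 4.6]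
  obtain ⟨τ, -⟩ := exists_cuspidal_glOne_hasSatakeParamAt_valueAtUniformizer h1 (1 : HeckeCharacter ℚ)
  obtain ⟨S₀, -, hmain⟩ := h 1 ℚ h1 one_pos τ τ
  obtain ⟨c, hc, hlim⟩ := hmain (S := Set.univ) (Set.subset_univ _)
    (α := fun _ => (0 : Multiset ℂ)) (β := fun _ => (0 : Multiset ℂ))
    (fun w hw => absurd (Set.mem_univ w) hw) (fun w hw => absurd (Set.mem_univ w) hw)
    (fun w hw => absurd (Set.mem_univ w) hw) (fun w hw => absurd (Set.mem_univ w) hw)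
    (s₀ := 1) Complex.one_re (Filter.Eventually.of_forall fun w => by simp)
  haveI : IsEmpty {w : HeightOneSpectrum (𝓞 ℚ) // w ∉ (Set.univ : Set (HeightOneSpectrum (𝓞 ℚ)))} :=
    ⟨fun w => w.2 (Set.mem_univ _)⟩
  have h0 : Tendsto (fun s : ℂ => (s - 1) *
      ∏' w : {w : HeightOneSpectrum (𝓞 ℚ) // w ∉ (Set.univ : Set (HeightOneSpectrum (𝓞 ℚ)))},
        ((satakePairPolynomial ((fun _ => (0 : Multiset ℂ)) w.1)
          ((fun _ => (0 : Multiset ℂ)) w.1)).eval ((w.1.residueCard : ℂ) ^ (-s)))⁻¹)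
      (𝓝[{s : ℂ | 1 < s.re}] 1) (𝓝 0) := by
    simp only [tprod_empty, mul_one]
    exact tendsto_sub_one_nhdsWithin_one_lt_re
  exact hc (tendsto_nhds_unique hlim h0)

/-- **`s₀ ∈ X` is load-bearing (no pole off `X`).** Witness: `n = 1`, `F = ℚ`, `π = π'` the trivial
character, `α = β = {1}`, `s₀ = 1 + i` (so `Re s₀ = 1`, and `s₀ ∉ X`): the partial product is `ζ_ℚ^S(s)`,
regular and non-zero at `1 + i` (Landau 1903; tree `tendsto_tprod_eulerFactor_one_of_ne_one_numberField`),
hence `(s - s₀) ζ_ℚ^S(s) → 0` and no non-zero limit exists. [cite: ArthurClozelAMS120, Ch. 3 §2 (2.2)–(2.3), p. 171] -/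
theorem pairLPoleJS_false_without_X :
    ¬ (∀ (n : ℕ) (F : Type) [Field F] [NumberField F] (hF : isCompact_glFiniteIntegralLevel n F), 0 < n →
        ∀ (π π' : CuspidalAutomorphicRepData n F hF),
        ∃ S₀ : Set (HeightOneSpectrum (𝓞 F)), S₀.Finite ∧
          ∀ {S : Set (HeightOneSpectrum (𝓞 F))}, S.Finite → S₀ ⊆ S →
          ∀ {α β : HeightOneSpectrum (𝓞 F) → Multiset ℂ},
            (∀ w ∉ S, π.1.HasSatakeParamAt w (α w)) → (∀ w ∉ S, π'.1.HasSatakeParamAt w (β w)) →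
            (∀ w ∉ S, ‖(α w).prod‖ = 1) → (∀ w ∉ S, ‖(β w).prod‖ = 1) →
            ∀ {s₀ : ℂ}, s₀.re = 1 →
              ∃ c : ℂ, c ≠ 0 ∧ Tendsto (fun s : ℂ => (s - s₀) *
                ∏' w : {w : HeightOneSpectrum (𝓞 F) // w ∉ S},
                  ((satakePairPolynomial (α w.1) (β w.1)).eval ((w.1.residueCard : ℂ) ^ (-s)))⁻¹)
                (𝓝[{s : ℂ | 1 < s.re}] s₀) (𝓝 c)) := by
  intro h
  have h1 : isCompact_glFiniteIntegralLevel 1 ℚ := isCompact_glFiniteIntegralLevel_holds 1 ℚ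
  -- the trivial character of `GL_1(𝔸_ℚ)`: Satake parameter `{1}` at all but finitely many places
  obtain ⟨τ, hτ'⟩ := exists_cuspidal_glOne_hasSatakeParamAt_valueAtUniformizer h1 (1 : HeckeCharacter ℚ)
  have hτ : ∀ᶠ w : HeightOneSpectrum (𝓞 ℚ) in cofinite, τ.1.HasSatakeParamAt w {1} := by
    filter_upwards [hτ'] with w hw
    have h1v : (1 : HeckeCharacter ℚ).valueAtUniformizer w = 1 := by
      rw [HeckeCharacter.valueAtUniformizer, HeckeCharacter.localComponent_apply,
        HeckeCharacter.one_apply, Units.val_one]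
    rwa [h1v] at hw
  obtain ⟨S₀, hS₀, hmain⟩ := h 1 ℚ h1 one_pos τ τ
  have hE : {w : HeightOneSpectrum (𝓞 ℚ) | ¬ τ.1.HasSatakeParamAt w {1}}.Finite :=
    Filter.eventually_cofinite.1 hτ
  obtain ⟨S, hSdef⟩ : ∃ S : Set (HeightOneSpectrum (𝓞 ℚ)),
      S = S₀ ∪ {w | ¬ τ.1.HasSatakeParamAt w {1}} := ⟨_, rfl⟩
  have hS : S.Finite := hSdef ▸ hS₀.union hE
  have hS₀S : S₀ ⊆ S := hSdef ▸ Set.subset_union_left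
  have hα : ∀ w ∉ S, τ.1.HasSatakeParamAt w ((fun _ => ({1} : Multiset ℂ)) w) := by
    intro w hw
    by_contra hno
    exact hw (hSdef ▸ Or.inr hno)
  have hu : ∀ w ∉ S, ‖((fun _ => ({1} : Multiset ℂ)) w).prod‖ = 1 := by
    intro w _
    simp
  have hre : (1 + Complex.I).re = 1 := by simp
  obtain ⟨c, hc, hlim⟩ := hmain hS hS₀S hα hα hu hu hre
  have hfun : (fun s : ℂ => (s - (1 + Complex.I)) * ∏' w : {w : HeightOneSpectrum (𝓞 ℚ) // w ∉ S},
      ((satakePairPolynomial ((fun _ => ({1} : Multiset ℂ)) w.1)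
        ((fun _ => ({1} : Multiset ℂ)) w.1)).eval ((w.1.residueCard : ℂ) ^ (-s)))⁻¹) =
      fun s : ℂ => (s - (1 + Complex.I)) * ∏' w : {w : HeightOneSpectrum (𝓞 ℚ) // w ∉ S},
        (1 - ((w.1.residueCard : ℂ) ^ (-s)))⁻¹ := by
    funext s
    congr 1
    refine tprod_congr fun w => ?_
    rw [eval_satakePairPolynomial_singleton, one_mul, one_mul]
  rw [hfun] at hlim
  have hne : (1 + Complex.I : ℂ) ≠ 1 := by
    intro h'
    have := congrArg Complex.im h'
    simp at this
  obtain ⟨c', -, hreg⟩ :=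
    tendsto_tprod_eulerFactor_one_of_ne_one_numberField (K := ℚ) hS (s₀ := 1 + Complex.I)
      (le_of_eq hre.symm) hne
  have h0 := (tendsto_sub_nhdsWithin_one_lt_re (1 + Complex.I)).mul hreg
  rw [zero_mul] at h0
  haveI := nhdsWithin_one_lt_re_neBot_of_re_eq_one hre
  exact hc (tendsto_nhds_unique hlim h0)

/-- The local factor of the rank-2 family `{1, -1} × {1, -1}` is `(1 - x²)²`. [folklore] -/
theorem eval_satakePairPolynomial_pm_one (x : ℂ) :
    (satakePairPolynomial ({1, -1} : Multiset ℂ) ({1, -1} : Multiset ℂ)).eval x =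
      (1 - x ^ 2) * (1 - x ^ 2) := by
  simp only [satakePairPolynomial, Multiset.insert_eq_cons, Multiset.cons_product, Multiset.product_cons,
    Multiset.product_singleton, Multiset.map_cons, Multiset.map_singleton, Multiset.prod_cons,
    Multiset.prod_singleton, Polynomial.eval_mul, Polynomial.eval_sub, Polynomial.eval_one,
    Polynomial.eval_C, Polynomial.eval_X, Multiset.singleton_add, Multiset.cons_add, Multiset.add_cons]
  ring

/-- **The Satake linkage is load-bearing (a unitary family IN `X` with NO pole).** Witness: `n = 2`,
`F = ℚ`, `α_w = β_w = {1, -1}`, `s₀ = 1`: `X` holds at every place (`q_w^0 · {1,-1} = {1,-1}⁻¹`), the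
family is unitary (`|∏ α_w| = 1`), and `L^S(s) = ∏_{p ∉ S} (1 - p^{-2s})^{-2} = ζ_ℚ^S(2s)²` is regular at
`s = 1` (continuity of `ζ_ℚ` at `2` through `tprod_eulerFactor_one_eq_dedekindZetaCont_mul_prod`), so
`(s - 1) L^S(s) → 0`: no non-zero limit. In rank `1` the weakened statement is TRUE
(`α_w β_w = q_w^{s₀-1}`, `L^S = ζ^S(s - s₀ + 1)`), so rank `2` is the minimal witness. [folklore] -/
theorem pairLPoleJS_false_without_satakeLink :
    ¬ (∀ (n : ℕ) (F : Type) [Field F] [NumberField F], 0 < n →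
        ∃ S₀ : Set (HeightOneSpectrum (𝓞 F)), S₀.Finite ∧
          ∀ {S : Set (HeightOneSpectrum (𝓞 F))}, S.Finite → S₀ ⊆ S →
          ∀ {α β : HeightOneSpectrum (𝓞 F) → Multiset ℂ},
            (∀ w ∉ S, Multiset.card (α w) = n) → (∀ w ∉ S, Multiset.card (β w) = n) →
            (∀ w ∉ S, ‖(α w).prod‖ = 1) → (∀ w ∉ S, ‖(β w).prod‖ = 1) →
            ∀ {s₀ : ℂ}, s₀.re = 1 →
              (∀ᶠ w in cofinite, (α w).map ((((w.residueCard : ℂ) ^ (1 - s₀))) * ·) = (β w).map (·⁻¹)) →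
              ∃ c : ℂ, c ≠ 0 ∧ Tendsto (fun s : ℂ => (s - s₀) *
                ∏' w : {w : HeightOneSpectrum (𝓞 F) // w ∉ S},
                  ((satakePairPolynomial (α w.1) (β w.1)).eval ((w.1.residueCard : ℂ) ^ (-s)))⁻¹)
                (𝓝[{s : ℂ | 1 < s.re}] s₀) (𝓝 c)) := by
  intro h
  obtain ⟨S, hS, hmain⟩ := h 2 ℚ two_pos
  have hX : ∀ᶠ w : HeightOneSpectrum (𝓞 ℚ) in cofinite,
      ((fun _ => ({1, -1} : Multiset ℂ)) w).map ((((w.residueCard : ℂ) ^ (1 - (1 : ℂ)))) * ·) =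
        ((fun _ => ({1, -1} : Multiset ℂ)) w).map (·⁻¹) :=
    Filter.Eventually.of_forall fun w => by simp
  obtain ⟨c, hc, hlim⟩ := hmain hS subset_rfl (α := fun _ => ({1, -1} : Multiset ℂ))
    (β := fun _ => ({1, -1} : Multiset ℂ)) (fun w _ => by simp) (fun w _ => by simp)
    (fun w _ => by simp) (fun w _ => by simp) Complex.one_re hX
  -- `Z = ζ_ℚ^S`
  set Z : ℂ → ℂ := fun s => ∏' w : {w : HeightOneSpectrum (𝓞 ℚ) // w ∉ S},
    (1 - ((w.1.residueCard : ℂ) ^ (-s)))⁻¹ with hZdef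
  -- the partial product of the family is `Z(2s)²` on `Re s > 1`
  have hfun : ∀ s : ℂ, 1 < s.re →
      (∏' w : {w : HeightOneSpectrum (𝓞 ℚ) // w ∉ S},
        ((satakePairPolynomial ((fun _ => ({1, -1} : Multiset ℂ)) w.1)
          ((fun _ => ({1, -1} : Multiset ℂ)) w.1)).eval ((w.1.residueCard : ℂ) ^ (-s)))⁻¹) =
        Z (2 * s) * Z (2 * s) := by
    intro s hs
    have hs2 : 1 < (2 * s).re := by
      simp only [Complex.mul_re, Complex.re_ofNat, Complex.im_ofNat, zero_mul, sub_zero]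
      linarith
    have hmulZ := multipliable_inv_one_sub_residueCard_cpow_neg (K := ℚ) S hs2
    rw [hZdef, ← hmulZ.tprod_mul hmulZ]
    refine tprod_congr fun w => ?_
    have hq : (w.1.residueCard : ℂ) ≠ 0 :=
      Nat.cast_ne_zero.2 (ne_of_gt (lt_trans zero_lt_one w.1.one_lt_residueCard))
    have hsq : ((w.1.residueCard : ℂ) ^ (-s)) ^ 2 = (w.1.residueCard : ℂ) ^ (-(2 * s)) := by
      rw [sq, ← Complex.cpow_add _ _ hq]
      congr 1
      ring
    rw [eval_satakePairPolynomial_pm_one, hsq, mul_inv]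
  -- continuity of `s ↦ Z (2s)` at `1`, through `ζ_ℚ`
  classical
  set E : ℂ → ℂ := fun s => ∏ v ∈ hS.toFinset, (1 - ((v.residueCard : ℂ) ^ (-s))) with hEdef
  have hcontH := Literature.NumberTheory.LFunctions.NumberField.exists_isDedekindZetaContinuation_holds ℚ
  have hζdiff := Literature.NumberTheory.LFunctions.differentiableOn_dedekindZetaCont_of_exists ℚ hcontH
  have h2ne : (2 : ℂ) * 1 ≠ 1 := by norm_num
  have hG : ContinuousAt (fun s : ℂ =>
      Literature.NumberTheory.LFunctions.dedekindZetaCont ℚ (2 * s) * E (2 * s)) 1 := by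
    have h2 : Continuous fun s : ℂ => 2 * s := continuous_const.mul continuous_id
    refine ContinuousAt.mul ?_ ?_
    · have hζ : ContinuousAt (Literature.NumberTheory.LFunctions.dedekindZetaCont ℚ) (2 * 1) :=
        (hζdiff.differentiableAt (isOpen_compl_singleton.mem_nhds h2ne)).continuousAt
      exact ContinuousAt.comp (g := Literature.NumberTheory.LFunctions.dedekindZetaCont ℚ) hζ
        h2.continuousAt
    · have hE : Continuous E := by
        refine continuous_finsetProd _ fun v _ => continuous_one_sub_residueCard_cpow_neg v
      exact (hE.comp h2).continuousAt
  have hZ2 : Tendsto (fun s : ℂ => Z (2 * s)) (𝓝[{s : ℂ | 1 < s.re}] 1)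
      (𝓝 (Literature.NumberTheory.LFunctions.dedekindZetaCont ℚ (2 * 1) * E (2 * 1))) := by
    refine (hG.tendsto.mono_left nhdsWithin_le_nhds).congr' ?_
    filter_upwards [self_mem_nhdsWithin] with s hs
    have hs2 : 1 < (2 * s).re := by
      simp only [Complex.mul_re, Complex.re_ofNat, Complex.im_ofNat, zero_mul, sub_zero]
      have : 1 < s.re := hs
      linarith
    exact (tprod_eulerFactor_one_eq_dedekindZetaCont_mul_prod hS hs2).symm
  -- `(s - 1) · Z(2s)² → 0 · Z(2)² = 0`
  have h0 : Tendsto (fun s : ℂ => (s - 1) *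
      ∏' w : {w : HeightOneSpectrum (𝓞 ℚ) // w ∉ S},
        ((satakePairPolynomial ((fun _ => ({1, -1} : Multiset ℂ)) w.1)
          ((fun _ => ({1, -1} : Multiset ℂ)) w.1)).eval ((w.1.residueCard : ℂ) ^ (-s)))⁻¹)
      (𝓝[{s : ℂ | 1 < s.re}] 1) (𝓝 0) := by
    have hprod := tendsto_sub_one_nhdsWithin_one_lt_re.mul (hZ2.mul hZ2)
    rw [zero_mul] at hprod
    refine hprod.congr' ?_
    filter_upwards [self_mem_nhdsWithin] with s hs
    rw [hfun s hs]
  exact hc (tendsto_nhds_unique hlim h0)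

end Summit.Langlands.Langlands.Theorems.PairLPoleJS.Negative

end
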